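import Summits.ResolutionOfSingularities.ResolutionOfSingularities.Theorems.HilbertSamuelEliminationSigmaMaxModificationsCorridor3LocalEmbedding
import Summits.ResolutionOfSingularities.ResolutionOfSingularities.Theorems.HilbertSamuelEliminationSigmaMaxModificationsCorridor3HypersurfaceOrder
import Summits.ResolutionOfSingularities.ResolutionOfSingularities.Theorems.HilbertSamuelEliminationSigmaMaxModificationsCorridor3TameValueHypersurface
import Summits.ResolutionOfSingularities.ResolutionOfSingularities.Theorems.HilbertSamuelEliminationSigmaMaxModificationsCorridor3HypersurfaceValues
import Literature.AlgebraicGeometry.Resolution.AlterationsBoundarySmoothLocus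
import Literature.AlgebraicGeometry.Resolution.SigmaMaxEliminationInDim
import Literature.AlgebraicGeometry.Resolution.RegularLocalRingsNormal
import Literature.AlgebraicGeometry.Resolution.RegularLocalRingsProofs
import Literature.AlgebraicGeometry.Resolution.HilbertSamuelLocal
import Literature.AlgebraicGeometry.Morphisms.IrreducibleAffineNeighbourhood
import Literature.AlgebraicGeometry.Motives.VarietiesDimensionProofs
import Literature.RingTheory.HilbertSamuel.RegularCriterion
import Mathlib.AlgebraicGeometry.FunctionField
import Mathlib.AlgebraicGeometry.IdealSheaf.Basic
import HarnessLib

/-!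
# `SigmaMaxModificationsCorridor3` (stmt-19249), line `tame_wild` v3: helper **T2** —
# the hypersurface chart at a closed point of a tame stratum

[OURS · L1 W4.2] lead res-L1-w42-lead-1's typed brick T2 of the confined transfer
`stub_confinedTameNu3_of_thor4` (crux `SigmaMaxModificationsCorridor3` stmt-19249, parent
`SigmaMaxModifications` stmt-18506): `stub_T2_hypersurfaceChart` (`L/res-L1-w42-lead-1/helpers-v3.lean`,
signature verbatim) and `stub_T2_hypersurfaceChart_ker` (the form consumed by the kernel assembly
`TameWild.confinedNu3_of_bricks`, p480768: `ι.ker = I` instead of `ι(U) = V(I)`); replaces the role of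
"choose local coordinates at a point of the Hilbert–Samuel stratum and read the stratum as the top
locus of a hypersurface"; NOT a statement of any manuscript under review.

Proof: T-emb (`exists_local_regular_embedding_le`, p479664) gives a regular affine chart
`ι₁ : U₁ ↪ Z₁` inside `Y ∖ A` with `dim 𝒪_{Z₁,y} = emb.dim 𝒪_{Y,y} = ψ_Y(y) + 1`; by H1 (p461635) the
stalk of `ker ι₁` (`stalkIdeal_ker_eq_ker_stalkMap`) is `(g)`, `g ∈ 𝔪^m ∖ 𝔪^{m+1}`
(`exists_stalkIdeal_ker_eq_span_singleton_of_mem_hsStratum`); spread the generator to a section `i`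
with `ker ι₁ = (i)` on an affine `V₁ ∋ y`, take an irreducible affine `V₂ ∋ y` and an affine `W ∋ y`
in `V₁ ∩ V₂`: `Z := W`, `U := ι₁⁻¹ W`, `ι := ι₁|_W`, `ker ι = (i|_W)`, `i|_W ≠ 0`; `dim W = dim 𝒪_{W,y} ≤ 4`;
the pointwise dictionary p466037 globalises (`idealOrder_le_and_support_eq_of_stalkIdeal_ker_principal`).
Sources: CJS LNM 2270 Def. 2.28/2.35, Thm. 2.3 [CossartJannsenSaito2020]; BGMW Def. 3.1.1–2 [BierstoneGrigorievMilmanWlodarczyk2011].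
-/

set_option linter.dupNamespace false -- mandated namespace of this single-conjunct summit

noncomputable section

open CategoryTheory AlgebraicGeometry TopologicalSpace Topology IsLocalRing
open Literature.AlgebraicGeometry.Resolution Literature.RingTheory.HilbertSamuel
open Summit.ResolutionOfSingularities.ResolutionOfSingularities.Theorems.SigmaMaxModificationsCorridor3.TameWild

namespace Summit.ResolutionOfSingularities.ResolutionOfSingularities.Theorems.SigmaMaxModificationsCorridor3.Helpers

universe u

/-! ## Step 1: the kernel of a closed immersion into a regular ambient of the embedding dimension
is principal at a point of a hypersurface stratum -/

/-- **[OURS · L1 W4.2] The kernel of a regular chart of the embedding dimension is principal at a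
point of a hypersurface stratum.** Let `ι : U ↪ Z` be a closed immersion of an open `U ⊆ Y`
(`Y` locally Noetherian), `y ∈ U` with `ψ_Y(y) ≤ N` and `y ∈ Y(hypersurfaceHFe (N+1) m)`, `m ≥ 2`,
and let `𝒪_{Z, ι y}` be regular of dimension `emb.dim 𝒪_{Y,y}`. Then the stalk of `ker ι` at
`ι y` is `(g)` with `g ∈ 𝔪^m ∖ 𝔪^{m+1}` (H1 `exists_ker_eq_span_singleton_of_mem_hsStratum` for the
surjection `𝒪_{Z,ι y} → 𝒪_{U,y} ≅ 𝒪_{Y,y}`, whose kernel is the stalk of `ker ι`,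
`stalkIdeal_ker_eq_ker_stalkMap`; `emb.dim 𝒪_{Y,y} = H(1) = ψ + 1`).
[cite: CossartJannsenSaito2020, Def. 2.28, Thm. 2.3] -/
theorem exists_stalkIdeal_ker_eq_span_singleton_of_mem_hsStratum
    {Y : Scheme.{u}} [IsLocallyNoetherian Y] {N m : ℕ} (hm : 2 ≤ m) {U : Y.Opens} {Z : Scheme.{u}}
    (ι : (U : Scheme.{u}) ⟶ Z) [IsClosedImmersion ι] (y : U)
    (hψ : Scheme.hsPsi Y y.1 ≤ N)
    (hy : y.1 ∈ Scheme.hsStratum Y N (hypersurfaceHFe (N + 1) m))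
    [IsRegularLocalRing (Z.presheaf.stalk (ι y))]
    (hdim : ringKrullDim (Z.presheaf.stalk (ι y)) =
      ((maximalIdeal (Y.presheaf.stalk y.1)).spanFinrank : WithBot ℕ∞)) :
    ∃ g : Z.presheaf.stalk (ι y), stalkIdeal ι.ker (ι y) = Ideal.span {g} ∧
      g ∈ maximalIdeal (Z.presheaf.stalk (ι y)) ^ m ∧
      g ∉ maximalIdeal (Z.presheaf.stalk (ι y)) ^ (m + 1) := by
  -- the surjection `𝒪_{Z, ι y} → 𝒪_{U, y} ≅ 𝒪_{Y, y}`
  let f : Z.presheaf.stalk (ι y) →+* Y.presheaf.stalk y.1 :=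
    (U.stalkIso y).hom.hom.comp (ι.stalkMap y).hom
  have hf : Function.Surjective f :=
    (ConcreteCategory.bijective_of_isIso (U.stalkIso y).hom).2.comp (ι.stalkMap_surjective y)
  -- `dim 𝒪_{Z, ι y} = emb.dim 𝒪_{Y,y} = ψ + 1`
  have h1 : hilbertFun (Y.presheaf.stalk y.1) 1 = Scheme.hsPsi Y y.1 + 1 :=
    hilbertFun_stalk_one_of_mem_hsStratum hψ hm hy
  have he : ringKrullDim (Z.presheaf.stalk (ι y)) = (Scheme.hsPsi Y y.1 + 1 : ℕ) := by
    rw [hdim, ← hilbertFun_one_eq_spanFinrank, h1]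
  obtain ⟨g, hker, hgm, hgm'⟩ := exists_ker_eq_span_singleton_of_mem_hsStratum hψ hm hy f hf he
  refine ⟨g, ?_, hgm, hgm'⟩
  rw [stalkIdeal_ker_eq_ker_stalkMap ι y, ← hker]
  -- `ker f = ker (stalkMap)`: the second factor is an isomorphism
  ext a
  simp only [RingHom.mem_ker, f, RingHom.coe_comp, Function.comp_apply]
  constructor
  · intro h
    rw [h, map_zero]
  · intro h
    exact (ConcreteCategory.bijective_of_isIso (U.stalkIso y).hom).1 (by rw [h, map_zero])

/-! ## Step 2: the support/order dictionary on a chart with stalkwise principal kernel -/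

/-- **[OURS · L1 W4.2] The support/order dictionary on a chart with stalkwise principal kernel.**
Let `ν = hypersurfaceHFe (N+1) m` (`m ≥ 1`) be maximal in `Σ_Y(N)` (`Y` locally Noetherian), `Z` a
regular scheme of dimension `≤ N + 1`, `ι : U ↪ Z` a closed immersion of an open `U ⊆ Y` whose
kernel ideal sheaf has a non-zero principal stalk `(g_z)` at every point. Then `ord_z(ker ι) ≤ m`
everywhere and `supp(Z, ker ι, ∅, m) = ι(U(ν))`: off `ι(U) = V(ker ι)` the order is `0`; at
`z = ι u`, `𝒪_{Y,u} ≅ 𝒪_{U,u} ≅ 𝒪_{Z,z}/(g_z)` and the pointwise dictionary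
`idealOrder_le_and_mem_support_iff_of_maximal` (p466037) applies (`H_U = H_Y|_U`,
`Scheme.hsFun_opens`). [cite: CossartJannsenSaito2020, Def. 2.28, Def. 2.35, Thm. 2.3]
[cite: BierstoneGrigorievMilmanWlodarczyk2011, Def. 3.1.2] -/
theorem idealOrder_le_and_support_eq_of_stalkIdeal_ker_principal
    {Y : Scheme.{u}} [IsLocallyNoetherian Y] {N m : ℕ} (hm : 1 ≤ m)
    (hν : Maximal (· ∈ Scheme.hsValues Y N) (hypersurfaceHFe (N + 1) m))
    {U : Y.Opens} {Z : Scheme.{u}} (hZreg : Scheme.IsRegular Z)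
    (hZdim : topologicalKrullDim Z ≤ ((N + 1 : ℕ) : WithBot ℕ∞))
    (ι : (U : Scheme.{u}) ⟶ Z) [IsClosedImmersion ι]
    (hI : ∀ z : Z, ∃ g : Z.presheaf.stalk z, g ≠ 0 ∧ stalkIdeal ι.ker z = Ideal.span {g}) :
    (∀ z : Z, idealOrder ι.ker z ≤ m) ∧
      (⟨ι.ker, [], m⟩ : MarkedIdeal Z).support =
        ι.base '' Scheme.hsStratum (U : Scheme.{u}) N (hypersurfaceHFe (N + 1) m) := by
  have hsupp : (ι.ker.support : Set Z) = Set.range ι := by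
    rw [ι.support_ker]
    exact ι.isClosedEmbedding.isClosed_range.closure_eq
  have key : ∀ z : Z, idealOrder ι.ker z ≤ m ∧
      (z ∈ (⟨ι.ker, [], m⟩ : MarkedIdeal Z).support ↔
        z ∈ ι.base '' Scheme.hsStratum (U : Scheme.{u}) N (hypersurfaceHFe (N + 1) m)) := by
    intro z
    by_cases hz : z ∈ Set.range ι
    · obtain ⟨u, rfl⟩ := hz
      obtain ⟨g, hg0, hIg⟩ := hI (ι u)
      haveI := hZreg (ι u)
      -- the dimension `e ≤ N + 1` of the regular local ring `𝒪_{Z, ι u}`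
      set e := (maximalIdeal (Z.presheaf.stalk (ι u))).spanFinrank with he_def
      have he : ringKrullDim (Z.presheaf.stalk (ι u)) = e :=
        (IsRegularLocalRing.spanFinrank_maximalIdeal (R := Z.presheaf.stalk (ι u))).symm
      have heN : e ≤ N + 1 := by
        have h1 : ringKrullDim (Z.presheaf.stalk (ι u)) ≤ topologicalKrullDim Z := by
          rw [Literature.AlgebraicGeometry.Motives.Scheme.topologicalKrullDim_eq_iSup_ringKrullDim_stalk]
          exact le_iSup (fun x : Z => ringKrullDim (Z.presheaf.stalk x)) (ι u)
        have h2 := (he.symm.trans_le h1).trans hZdim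
        exact_mod_cast h2
      -- the order `m' ≥ 1` of the generator `g ∈ 𝔪`
      have hgmax : g ∈ maximalIdeal (Z.presheaf.stalk (ι u)) := by
        have hsup : ι u ∈ (ι.ker.support : Set Z) := by
          rw [hsupp]; exact ⟨u, rfl⟩
        have h := (mem_support_iff_stalkIdeal_le ι.ker (ι u)).mp hsup
        rw [hIg, Ideal.span_singleton_le_iff_mem] at h
        exact h
      obtain ⟨m', hgm, hgm'⟩ := exists_mem_pow_and_not_mem_pow_succ hg0
      have hm' : 1 ≤ m' := by
        by_contra h
        have h0 : m' = 0 := by omega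
        subst h0
        rw [zero_add, pow_one] at hgm'
        exact hgm' hgmax
      -- `𝒪_{Y,u} ≅ 𝒪_{Z, ι u} / (g)`
      have hkerg : RingHom.ker (ι.stalkMap u).hom = Ideal.span {g} := by
        rw [← stalkIdeal_ker_eq_ker_stalkMap, hIg]
      let ε : Y.presheaf.stalk u.1 ≃+* Z.presheaf.stalk (ι u) ⧸ Ideal.span {g} :=
        (U.stalkIso u).commRingCatIsoToRingEquiv.symm.trans
          ((RingHom.quotientKerEquivOfSurjective (ι.stalkMap_surjective u)).symm.trans
            (Ideal.quotEquivOfEq hkerg))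
      obtain ⟨hord, hiff⟩ := idealOrder_le_and_mem_support_iff_of_maximal hν
        (⟨ι.ker, [], m⟩ : MarkedIdeal Z) rfl he heN hm' hIg hgm hgm' ε
      refine ⟨hord, ?_⟩
      rw [hiff]
      constructor
      · intro hu1
        refine ⟨u, ?_, rfl⟩
        rw [Scheme.mem_hsStratum_iff, Scheme.hsFun_opens]
        exact Scheme.mem_hsStratum_iff.mp hu1
      · rintro ⟨u', hu', huu'⟩
        have h := ι.isClosedEmbedding.injective huu'
        subst h
        rw [Scheme.mem_hsStratum_iff, Scheme.hsFun_opens] at hu'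
        exact Scheme.mem_hsStratum_iff.mpr hu'
    · -- off the image `I_z = 𝒪_{Z,z}` and the order is `0`
      have hz' : z ∉ (ι.ker.support : Set Z) := by
        rw [hsupp]; exact hz
      have hord : idealOrder ι.ker z = 0 := by
        have h1 : ¬ (1 : ℕ∞) ≤ idealOrder ι.ker z := by
          rw [one_le_idealOrder_iff]; exact hz'
        exact Order.lt_one_iff.mp (not_le.mp h1)
      refine ⟨by rw [hord]; exact bot_le, ?_⟩
      constructor
      · intro hzs
        exfalso
        have h := hzs
        change ((m : ℕ) : ℕ∞) ≤ idealOrder ι.ker z at h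
        rw [hord, nonpos_iff_eq_zero, Nat.cast_eq_zero] at h
        omega
      · rintro ⟨u, -, rfl⟩
        exact absurd ⟨u, rfl⟩ hz
  exact ⟨fun z => (key z).1, Set.ext fun z => (key z).2⟩

/-- A closed point of a space is a closed point of any subspace containing it. [folklore] -/
theorem isClosed_singleton_subtype_mk {X : Type*} [TopologicalSpace X] {S : Set X} {x : X}
    (hx : x ∈ S) (h : IsClosed ({x} : Set X)) : IsClosed ({(⟨x, hx⟩ : S)} : Set S) := by
  have e : ({(⟨x, hx⟩ : S)} : Set S) = Subtype.val ⁻¹' {x} := by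
    ext z; simp only [Set.mem_singleton_iff, Set.mem_preimage, Subtype.ext_iff]
  rw [e]
  exact h.preimage continuous_subtype_val

/-! ## Step 3: the hypersurface chart -/

/-- **[OURS · L1 W4.2] T2 in the form consumed by the kernel assembly `TameWild.confinedNu3_of_bricks`
(p480768, hypothesis `hT2` verbatim; `ι.ker = I`).** At a CLOSED point `y` of the stratum `Y(ν)`,
`ν = hypersurfaceHF m`, `m ≥ 2` (`Y` reduced, locally of finite type over `k`, `dim Y ≤ 3`, `ν`
maximal), avoiding a finite set `A` of closed points: an open `U ∋ y` disjoint from `A`, a regular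
integral affine `Z` (separated, quasi-compact, locally of finite type over `k`, `dim Z ≤ 4`), a closed
immersion `ι : U ↪ Z` over `k` whose kernel `I` is a non-zero effective Cartier ideal sheaf, with
`supp(Z, I, ∅, m) = ι(U(ν))` and `ord I ≤ m`. (Perfectness and `p` are not used.)
[cite: CossartJannsenSaito2020, Def. 2.28, Def. 2.35, Thm. 2.3]
[cite: BierstoneGrigorievMilmanWlodarczyk2011, Def. 3.1.1, Def. 3.1.2] -/
theorem stub_T2_hypersurfaceChart_ker (p : ℕ) (hp : p.Prime) (k : Type) [Field k] [CharP k p]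
    [PerfectField k] (Y : Scheme.{0}) (g : Y ⟶ Spec (.of k)) [LocallyOfFiniteType g] [IsReduced Y]
    (hY : topologicalKrullDim Y ≤ ((3 : ℕ) : WithBot ℕ∞)) (ν : ℕ → ℕ)
    (hν : Maximal (· ∈ Scheme.hsValues Y 3) ν) (m : ℕ) (hm : 2 ≤ m) (hνm : ν = hypersurfaceHF m)
    (y : Y) (hy : y ∈ Scheme.hsStratum Y 3 ν) (hyc : IsClosed ({y} : Set Y))
    (A : Set Y) (hA : A.Finite) (hAc : ∀ a ∈ A, IsClosed ({a} : Set Y)) (hyA : y ∉ A) :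
    ∃ (U : Y.Opens) (_ : y ∈ U) (Z : Scheme.{0}) (h : Z ⟶ Spec (.of k)) (I : Z.IdealSheafData)
      (ι : (U : Scheme.{0}) ⟶ Z),
      Disjoint (U : Set Y) A ∧ IsSeparated h ∧ LocallyOfFiniteType h ∧ QuasiCompact h ∧
      IsIntegral Z ∧ Scheme.IsRegular Z ∧ IsAffine Z ∧
      topologicalKrullDim Z ≤ ((4 : ℕ) : WithBot ℕ∞) ∧ I ≠ ⊥ ∧ IsEffectiveCartier I ∧
      IsClosedImmersion ι ∧ ι ≫ h = U.ι ≫ g ∧ ι.ker = I ∧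
      (⟨I, [], m⟩ : MarkedIdeal Z).support = ι.base '' Scheme.hsStratum (U : Scheme.{0}) 3 ν ∧
      ∀ z : Z, idealOrder I z ≤ (m : ℕ∞) := by
  have _ := hp
  haveI : IsLocallyNoetherian Y := LocallyOfFiniteType.isLocallyNoetherian g
  -- normalise the value: `ν = hypersurfaceHFe 4 m`
  subst hνm
  rw [← hypersurfaceHFe_four] at hν hy ⊢
  -- the open `G = Y ∖ A`
  have hAcl : IsClosed A := by
    rw [← Set.biUnion_of_singleton A]
    exact hA.isClosed_biUnion hAc
  let G : Y.Opens := ⟨Aᶜ, hAcl.isOpen_compl⟩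
  have hyG : y ∈ G := hyA
  -- T-emb: a regular affine chart of the embedding dimension at `y`, inside `G`
  obtain ⟨U₁, hyU₁, Z₁, h₁, ι₁, hU₁G, -, hι₁, hcomp₁, hZ₁reg, hft₁, hZ₁aff, hdim₁⟩ :=
    exists_local_regular_embedding_le k Y g y G hyG
  haveI := hι₁
  haveI := hft₁
  haveI : IsAffine Z₁ := hZ₁aff
  haveI : IsLocallyNoetherian Z₁ := LocallyOfFiniteType.isLocallyNoetherian h₁
  haveI hdom : ∀ z : Z₁, IsDomain (Z₁.presheaf.stalk z) := fun z =>
    haveI := hZ₁reg z; isDomain_of_isRegularLocalRing _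
  haveI : IsReduced Z₁ := isReduced_of_isReduced_stalk Z₁
  let y₁ : (U₁ : Scheme.{0}) := ⟨y, hyU₁⟩
  let z₁ : Z₁ := ι₁ y₁
  haveI : IsRegularLocalRing (Z₁.presheaf.stalk z₁) := hZ₁reg z₁
  -- the kernel at `z₁` is principal, generated by an element of order `m`
  have hψ : Scheme.hsPsi Y y ≤ 3 := Scheme.hsPsi_le_of_topologicalKrullDim_le hY y
  obtain ⟨g₁, hIg₁, hg₁m, hg₁m'⟩ :=
    exists_stalkIdeal_ker_eq_span_singleton_of_mem_hsStratum hm ι₁ y₁ hψ hy hdim₁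
  have hg₁0 : g₁ ≠ 0 := fun h0 => hg₁m' (h0 ▸ zero_mem _)
  -- spread the generator: `ι₁.ker (V₁) = (i₁)` on an affine open `V₁ ∋ z₁`
  obtain ⟨V₀, hV₀, hzV₀, -⟩ :=
    exists_isAffineOpen_mem_and_subset (X := Z₁) (x := z₁) (U := ⊤) trivial
  have hspan : Ideal.span ((Z₁.presheaf.germ V₀ z₁ hzV₀).hom '' (ι₁.ker.ideal ⟨V₀, hV₀⟩)) =
      Ideal.span {g₁} := by
    rw [← hIg₁, stalkIdeal_eq_map_germ ι₁.ker ⟨V₀, hV₀⟩ hzV₀, Ideal.map]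
  obtain ⟨_, ⟨i₀, hi₀, rfl⟩, hgen⟩ := exists_mem_span_singleton_eq_of_span_eq hg₁0 hspan
  have hIi₀ : stalkIdeal ι₁.ker z₁ = Ideal.span {(Z₁.presheaf.germ V₀ z₁ hzV₀).hom i₀} := by
    rw [hgen, hIg₁]
  obtain ⟨V₁, hV₁V₀, hzV₁, hIV₁⟩ :=
    exists_ideal_eq_span_singleton_of_stalkIdeal_eq ι₁.ker ⟨V₀, hV₀⟩ hzV₀ i₀ hi₀ hIi₀
  set i₁ : Γ(Z₁, V₁) := Z₁.presheaf.map (homOfLE hV₁V₀).op i₀ with hi₁_def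
  have hi₁0 : (Z₁.presheaf.germ V₁ z₁ hzV₁).hom i₁ ≠ 0 := by
    rw [hi₁_def]
    change (Z₁.presheaf.germ V₁ z₁ hzV₁) ((Z₁.presheaf.map (homOfLE hV₁V₀).op) i₀) ≠ 0
    rw [TopCat.Presheaf.germ_res_apply]
    intro h0
    change (Z₁.presheaf.germ V₀ z₁ hzV₀).hom i₀ = 0 at h0
    rw [h0, Ideal.span_singleton_eq_bot.mpr rfl, eq_comm, Ideal.span_singleton_eq_bot] at hgen
    exact hg₁0 hgen
  -- an irreducible affine open `V₂ ∋ z₁`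
  obtain ⟨V₂, -, hzV₂, hV₂irr⟩ :=
    Literature.AlgebraicGeometry.Morphisms.exists_isAffineOpen_irreducibleSpace_of_isDomain_stalk
      Z₁ z₁
  -- the chart: an affine open `W ∋ z₁` inside `V₁ ∩ V₂`
  obtain ⟨W, hW, hzW, hWle⟩ :=
    exists_isAffineOpen_mem_and_subset (X := Z₁) (x := z₁) (U := V₁ ⊓ V₂) ⟨hzV₁, hzV₂⟩
  have hWV₁ : W ≤ V₁ := fun x hx => (hWle hx).1
  have hWV₂ : W ≤ V₂ := fun x hx => (hWle hx).2
  haveI : IsAffine (W : Scheme.{0}) := hW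
  have hWirr' : IsIrreducible (W : Set Z₁) :=
    ⟨⟨z₁, hzW⟩, (isIrreducible_iff_irreducibleSpace.mpr hV₂irr).2.open_subset W.isOpen hWV₂⟩
  haveI : IrreducibleSpace (W : Scheme.{0}) := Subtype.irreducibleSpace hWirr'
  haveI : IsIntegral (W : Scheme.{0}) := isIntegral_of_irreducibleSpace_of_isReduced _
  have hWreg : Scheme.IsRegular (W : Scheme.{0}) := fun w =>
    haveI := hZ₁reg w.1
    IsRegularLocalRing.of_ringEquiv (W.stalkIso w).commRingCatIsoToRingEquiv.symm
  -- the structure morphism, the open `U ∋ y` and the closed immersion `ι : U ↪ W`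
  let h : (W : Scheme.{0}) ⟶ Spec (.of k) := W.ι ≫ h₁
  let U₀ : (U₁ : Scheme.{0}).Opens := ι₁ ⁻¹ᵁ W
  have hyU₀ : y₁ ∈ U₀ := hzW
  let U : Y.Opens := U₁.ι ''ᵁ U₀
  have hUU₁ : U ≤ U₁ := U₁.ι_image_le U₀
  have hyU : y ∈ U := by
    have h1 := (U₁.ι.apply_mem_image_iff (U := U₀) (x := y₁)).mpr hyU₀
    exact h1
  let ι : (U : Scheme.{0}) ⟶ W := (U₁.ι.isoImage U₀).inv ≫ (ι₁ ∣_ W)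
  have hIeq : ι.ker = (ι₁ ∣_ W).ker := Scheme.Hom.ker_comp_of_isIso _ _
  -- the global generator `j ∈ Γ(W, 𝒪)` of `ι.ker`
  have hWtop : W.ι ''ᵁ ⊤ ≤ V₁ := (W.ι_image_le ⊤).trans hWV₁
  let j : Γ(W, ⊤) := Z₁.presheaf.map (homOfLE hWtop).op i₁
  have hItop : ι.ker.ideal ⟨⊤, isAffineOpen_top _⟩ = Ideal.span {j} := by
    rw [hIeq, Scheme.ker_morphismRestrict_ideal]
    change ι₁.ker.ideal ⟨W.ι ''ᵁ ⊤, _⟩ = _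
    rw [← ι₁.ker.map_ideal (U := ⟨W.ι ''ᵁ ⊤, (isAffineOpen_top _).image_of_isOpenImmersion _⟩)
      (V := V₁) hWtop, hIV₁, Ideal.map_span, Set.image_singleton]
    rfl
  have hz₁top : z₁ ∈ W.ι ''ᵁ (⊤ : (W : Scheme.{0}).Opens) :=
    (W.ι.apply_mem_image_iff (U := ⊤) (x := (⟨z₁, hzW⟩ : W))).mpr trivial
  have hj0 : j ≠ 0 := by
    intro h0
    apply hi₁0
    have h1 : (Z₁.presheaf.germ (W.ι ''ᵁ ⊤) z₁ hz₁top).hom j = (Z₁.presheaf.germ V₁ z₁ hzV₁).hom i₁ := by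
      change (Z₁.presheaf.germ _ z₁ hz₁top) ((Z₁.presheaf.map (homOfLE hWtop).op) i₁) = _
      rw [TopCat.Presheaf.germ_res_apply]
    rw [← h1, h0]
    exact map_zero _
  -- stalkwise: `ι.ker` is principal and non-zero everywhere on the integral scheme `W`
  have hIstalk : ∀ w : (W : Scheme.{0}), ∃ gw : (W : Scheme.{0}).presheaf.stalk w, gw ≠ 0 ∧
      stalkIdeal ι.ker w = Ideal.span {gw} := by
    intro w
    refine ⟨((W : Scheme.{0}).presheaf.germ ⊤ w trivial).hom j, ?_, ?_⟩
    · intro h0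
      apply hj0
      apply germ_injective_of_isIntegral (W : Scheme.{0}) (U := ⊤) w trivial
      change ((W : Scheme.{0}).presheaf.germ ⊤ w trivial).hom j = ((W : Scheme.{0}).presheaf.germ ⊤ w trivial).hom 0
      rw [h0, map_zero]
    · rw [stalkIdeal_eq_map_germ ι.ker ⟨⊤, isAffineOpen_top _⟩ trivial, hItop, Ideal.map_span,
        Set.image_singleton]
  -- the closed point `w₁ = ι y` of `W` and the dimension of `W`
  let w₁ : (W : Scheme.{0}) := ⟨z₁, hzW⟩
  have hy₁c : IsClosed ({y₁} : Set (U₁ : Scheme.{0})) := isClosed_singleton_subtype_mk hyU₁ hyc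
  have hz₁c : IsClosed ({z₁} : Set Z₁) := by
    rw [← Set.image_singleton]
    exact ι₁.isClosedEmbedding.isClosedMap _ hy₁c
  have hw₁c : IsClosed ({w₁} : Set (W : Scheme.{0})) := isClosed_singleton_subtype_mk hzW hz₁c
  have hdimW : topologicalKrullDim (W : Scheme.{0}) ≤ ((4 : ℕ) : WithBot ℕ∞) := by
    rw [← ringKrullDim_stalk_eq_of_isClosed h hw₁c,
      ringKrullDim_eq_of_ringEquiv (W.stalkIso w₁).commRingCatIsoToRingEquiv]
    change ringKrullDim (Z₁.presheaf.stalk z₁) ≤ _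
    rw [hdim₁, ← hilbertFun_one_eq_spanFinrank, hilbertFun_stalk_one_of_mem_hsStratum hψ hm hy]
    exact_mod_cast (show Scheme.hsPsi Y y + 1 ≤ 4 by omega)
  -- the dictionary
  obtain ⟨hord, hsuppM⟩ := idealOrder_le_and_support_eq_of_stalkIdeal_ker_principal (N := 3)
    (by omega) hν hWreg hdimW ι hIstalk
  -- compatibility with the structure morphisms
  have hcomp : ι ≫ h = U.ι ≫ g := by
    change ((U₁.ι.isoImage U₀).inv ≫ (ι₁ ∣_ W)) ≫ W.ι ≫ h₁ = _
    simp only [Category.assoc, morphismRestrict_ι_assoc]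
    rw [hcomp₁, Scheme.Hom.isoImage_inv_ι_assoc]
  -- assemble
  refine ⟨U, hyU, W, h, ι.ker, ι, ?_, inferInstance, inferInstance, inferInstance, inferInstance,
    hWreg, hW, hdimW, ?_, ?_, inferInstance, hcomp, rfl, hsuppM, hord⟩
  · -- `U ∩ A = ∅`
    exact Set.disjoint_left.mpr fun x hxU hxA => hU₁G (hUU₁ hxU) hxA
  · -- `ι.ker ≠ 0`
    intro hbot
    have h1 := hItop
    rw [hbot] at h1
    change (⊥ : Ideal Γ(W, ⊤)) = Ideal.span {j} at h1
    rw [eq_comm, Ideal.span_singleton_eq_bot] at h1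
    exact hj0 h1
  · -- `ι.ker` is an effective Cartier divisor: one chart `(W, j)`
    intro w
    refine ⟨⟨⊤, isAffineOpen_top _⟩, trivial, j, mem_nonZeroDivisors_of_ne_zero hj0, hItop⟩

/-- **[OURS · L1 W4.2] T2 (lead-1's typed helper `stub_T2_hypersurfaceChart`,
`L/res-L1-w42-lead-1/helpers-v3.lean`, signature verbatim): the hypersurface chart at a closed
point of a tame stratum,** with `ι(U) = V(I)` (from `stub_T2_hypersurfaceChart_ker`: the support of
the kernel of a closed immersion is its (closed) image, `Scheme.Hom.support_ker`).
[cite: CossartJannsenSaito2020, Def. 2.28, Def. 2.35, Thm. 2.3]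
[cite: BierstoneGrigorievMilmanWlodarczyk2011, Def. 3.1.1, Def. 3.1.2] -/
theorem stub_T2_hypersurfaceChart (p : ℕ) (hp : p.Prime) (k : Type) [Field k] [CharP k p]
    [PerfectField k] (Y : Scheme.{0}) (g : Y ⟶ Spec (.of k)) [LocallyOfFiniteType g] [IsReduced Y]
    (hY : topologicalKrullDim Y ≤ ((3 : ℕ) : WithBot ℕ∞)) (ν : ℕ → ℕ)
    (hν : Maximal (· ∈ Scheme.hsValues Y 3) ν) (m : ℕ) (hm : 2 ≤ m) (hνm : ν = hypersurfaceHF m)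
    (y : Y) (hy : y ∈ Scheme.hsStratum Y 3 ν) (hyc : IsClosed ({y} : Set Y))
    (A : Set Y) (hA : A.Finite) (hAc : ∀ a ∈ A, IsClosed ({a} : Set Y)) (hyA : y ∉ A) :
    ∃ (U : Y.Opens) (_ : y ∈ U) (Z : Scheme.{0}) (h : Z ⟶ Spec (.of k)) (I : Z.IdealSheafData)
      (ι : (U : Scheme.{0}) ⟶ Z),
      Disjoint (U : Set Y) A ∧ IsSeparated h ∧ LocallyOfFiniteType h ∧ QuasiCompact h ∧
      IsIntegral Z ∧ Scheme.IsRegular Z ∧ IsAffine Z ∧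
      topologicalKrullDim Z ≤ ((4 : ℕ) : WithBot ℕ∞) ∧ I ≠ ⊥ ∧ IsEffectiveCartier I ∧
      IsClosedImmersion ι ∧ ι ≫ h = U.ι ≫ g ∧ Set.range ι.base = (I.support : Set Z) ∧
      (⟨I, [], m⟩ : MarkedIdeal Z).support = ι.base '' Scheme.hsStratum (U : Scheme.{0}) 3 ν ∧
      ∀ z : Z, idealOrder I z ≤ (m : ℕ∞) := by
  obtain ⟨U, hyU, Z, h, I, ι, hA', hsep, hlft, hqc, hZi, hZr, hZa, hZd, hI0, hIc, hι, hcomp, hker,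
    hsupp, hord⟩ := stub_T2_hypersurfaceChart_ker p hp k Y g hY ν hν m hm hνm y hy hyc A hA hAc hyA
  haveI := hι
  refine ⟨U, hyU, Z, h, I, ι, hA', hsep, hlft, hqc, hZi, hZr, hZa, hZd, hI0, hIc, hι, hcomp, ?_,
    hsupp, hord⟩
  rw [← hker, ι.support_ker]
  exact ι.isClosedEmbedding.isClosed_range.closure_eq.symm

end Summit.ResolutionOfSingularities.ResolutionOfSingularities.Theorems.SigmaMaxModificationsCorridor3.Helpers

end
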